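import Summits.QuantumFields.BalabanUV.Beta.StencilTableData

/-!
# Beta / StencilTableDataSorted — LINEAR-COST KERNEL CHECKS for typed rational stencil tables of the cell's size: an in-kernel fuel merge sort, the
# table symmetry `K[−x] = K[x]ᵀ` by SORT-AND-COMPARE, and the table norms from SORTED keys (β sub-cell, BINDER-OWNERS row CAP-k, lineage
# `b2b-balaban-beta-an5`, gen 28; node BETA-an5-g28-EXPSUM, leaf 3b — sibling of `StencilTableData`)

WHY.  `StencilTableData.negTCheck` and `normCheck` decide `MatNegTranspose` and the table norms by per-entry LOOKUPS (`entryQ` scans the block) and by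
`List.Nodup` of the key list — quadratic in the block size.  The cell's own `k₀` (per-colour scalar block `k_sc` of the SU(2), L = 3 KKT symbol) has
a 3 768-entry block at the origin: ≈ 3·10⁷ ∕ 7·10⁶ kernel steps — too slow for `decide +kernel`.  This module gives LINEAR ∕ `n log n` checks with the
SAME conclusions, for tables exported in CANONICAL form (one block per offset, entries sorted by key):
* §1 `mergeF`∕`msortF` — a fuel-bounded merge sort (structural recursion; the kernel evaluates it) with `msortF_perm : msortF le n l ~ l`.
* §2 `valAt_perm` (the summed entry is invariant under permutations of a block), `valAt_map_tEntry`, `blockAt_eq_of_nodup` (one block per offset).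
* §3 **`negTCheckSorted T : Bool`** — `offsets.Nodup`, and for every block `(x, blk)` some block `(−x, blk')` with `blk' = msortF (t blk)` where
  `t (i, j, v) = (j, i, v)` and the sort key is `i·N + j`; **`matNegTranspose_family_of_sorted`** (the binder `hAn`).  Cost `Σ_x |blk_x| log |blk_x|`.
* §4 `keyNat`, `strictIncr` (structural), **`normCheckSorted T ν : Bool`** (keys strictly increasing in `i·N + j` ⟹ distinct; `Σ v² ≤ ν_x²`, `0 ≤ ν_x`),
  **`norm_K_le_of_normCheckSorted`** (the hypothesis `hν` of `StencilExpSums`).  Cost linear.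
* §5 the composition ENDs of `StencilTableData` §5 re-issued on the sorted checks: `tableSup_family_of_sortedChecks`, `taylorTail_family_le_of_sortedChecks`.
The quadratic `covCheck` of `StencilTableCovariance` is NOT re-issued here (its key map mixes index-dependent offset shifts; a linear variant needs the
same sort applied to whole-table key lists — left for the export's generation).

HONEST FRAMING.  Kernel data-structure glue ([folklore]: merge sort is a permutation); no table of the cell in this file (the cell's `k₀` is checked
OFF-TREE as evidence with these functions); 0 binders of the real row instantiated; 0 certified coefficients; discharging `BetaPertH` would make
Bałaban's ultraviolet stability UNCONDITIONAL — NOT the continuum limit, NOT the Clay problem.  HONEST DEPENDENCY: continuum YM on T⁴ ⇐ BetaPertH ∧ nine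
spine estimates (0∕9 proved); BetaPertH ⇐ (D1) ∧ (D4) ∧ CAP+tail; G-an2-4 gates asym, D1 and NE2∕3∕4.  0 `sorry`, 0 cite tags.
-/

namespace Summit.QuantumFields.BalabanUV.Beta.StencilTableData

open Complex Set Matrix Finset
open Summit.QuantumFields.BalabanUV.Beta.PolyRegularAlgebra (character)
open Summit.QuantumFields.BalabanUV.Beta.TubeMaximumModulus (VertexTori)
open Summit.QuantumFields.BalabanUV.Beta.VertexToriSymmetry (MatNegTranspose matNegTranspose_characterSum)
open Summit.QuantumFields.BalabanUV.Beta.ResolventBoxCertificate (frobSq l2_opNorm_le_frobenius taylorTail)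
open Summit.QuantumFields.BalabanUV.Beta.StencilExpSums
open Literature.Analysis.ValidatedNumerics.ExpSum (checkUB)
open scoped Real ComplexConjugate Matrix.Norms.L2Operator

noncomputable section

/-! ## §1 A fuel-bounded merge sort the kernel evaluates -/

section MergeSort

variable {α : Type*} (le : α → α → Bool)

/-- fuel-bounded merge of two lists (structural in the fuel). [folklore] -/
def mergeF : ℕ → List α → List α → List α
  | 0, l₁, l₂ => l₁ ++ l₂
  | _ + 1, [], l₂ => l₂
  | _ + 1, l₁, [] => l₁
  | f + 1, a :: l₁, b :: l₂ => if le a b then a :: mergeF f l₁ (b :: l₂) else b :: mergeF f (a :: l₁) l₂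

/-- the merge is a permutation of the concatenation (any fuel). [folklore] -/
theorem mergeF_perm : ∀ (f : ℕ) (l₁ l₂ : List α), (mergeF le f l₁ l₂).Perm (l₁ ++ l₂)
  | 0, l₁, l₂ => List.Perm.refl _
  | _ + 1, [], l₂ => by simp [mergeF]
  | _ + 1, a :: l₁, [] => by simp [mergeF]
  | f + 1, a :: l₁, b :: l₂ => by
    simp only [mergeF]
    split
    · exact (mergeF_perm f l₁ (b :: l₂)).cons a
    · have h := (mergeF_perm f (a :: l₁) l₂).cons b
      refine h.trans ?_
      -- b :: (a :: l₁ ++ l₂) ~ a :: l₁ ++ b :: l₂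
      simpa using (List.perm_middle (a := b) (l₁ := a :: l₁) (l₂ := l₂)).symm

/-- fuel-bounded merge sort (structural in the fuel; split by `take`∕`drop`). [folklore] -/
def msortF : ℕ → List α → List α
  | 0, l => l
  | f + 1, l =>
    match l with
    | [] => []
    | [a] => [a]
    | a :: b :: rest =>
      let n := (a :: b :: rest).length / 2
      mergeF le (a :: b :: rest).length (msortF f ((a :: b :: rest).take n)) (msortF f ((a :: b :: rest).drop n))

/-- the sort is a permutation of its input (any fuel). [folklore] -/
theorem msortF_perm : ∀ (f : ℕ) (l : List α), (msortF le f l).Perm l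
  | 0, l => List.Perm.refl _
  | f + 1, [] => by simp [msortF]
  | f + 1, [a] => by simp [msortF]
  | f + 1, a :: b :: rest => by
    simp only [msortF]
    refine (mergeF_perm le _ _ _).trans ?_
    refine ((msortF_perm f _).append (msortF_perm f _)).trans ?_
    rw [List.take_append_drop]

end MergeSort

namespace QTable

variable {d N : ℕ} (T : QTable d N)

/-! ## §2 Permutation invariance of the summed entry; one block per offset -/

omit T in
/-- the summed entry of a block is invariant under permutations of the block. [folklore] -/
theorem valAt_perm {l₁ l₂ : List (Fin N × Fin N × ℚ)} (h : l₁.Perm l₂) (i j : Fin N) : valAt l₁ i j = valAt l₂ i j := by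
  unfold valAt
  exact ((h.filter _).map _).sum_eq

/-- the transposed entry. [folklore] -/
def tEntry (e : Fin N × Fin N × ℚ) : Fin N × Fin N × ℚ := (e.2.1, e.1, e.2.2)

omit T in
/-- summed entries of the transposed block. [folklore] -/
theorem valAt_map_tEntry (l : List (Fin N × Fin N × ℚ)) (i j : Fin N) : valAt (l.map tEntry) j i = valAt l i j := by
  unfold valAt
  rw [List.filter_map, List.map_map]
  have h1 : ((fun e : Fin N × Fin N × ℚ => e.2.2) ∘ tEntry) = fun e => e.2.2 := by funext e; rfl
  have h2 : ((fun e : Fin N × Fin N × ℚ => decide (e.1 = j ∧ e.2.1 = i)) ∘ tEntry) = fun e => decide (e.1 = i ∧ e.2.1 = j) := by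
    funext e
    by_cases ha : e.1 = i <;> by_cases hb : e.2.1 = j <;> simp [Function.comp, tEntry, ha, hb]
  rw [h1, h2]

omit T in
/-- in a list of blocks with distinct offsets, filtering on an offset that occurs returns that one block. [folklore] -/
theorem filter_offset_eq_singleton : ∀ {L : List ((Fin (d + 1) → ℤ) × List (Fin N × Fin N × ℚ))},
    (L.map Prod.fst).Nodup → ∀ {x : Fin (d + 1) → ℤ} {blk : List (Fin N × Fin N × ℚ)}, (x, blk) ∈ L →
      L.filter (fun b => decide (b.1 = x)) = [(x, blk)]
  | [], _, _, _, hb => by simp at hb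
  | c :: L, hnd, x, blk, hb => by
    rw [List.map_cons, List.nodup_cons] at hnd
    rcases List.mem_cons.mp hb with h | h
    · subst h
      rw [List.filter_cons_of_pos (by simp)]
      congr 1
      rw [List.filter_eq_nil_iff]
      intro b hbL hbx
      rw [decide_eq_true_eq] at hbx
      exact hnd.1 (List.mem_map.mpr ⟨b, hbL, hbx⟩)
    · have hcx : c.1 ≠ x := fun hcx => hnd.1 (List.mem_map.mpr ⟨(x, blk), h, hcx.symm ▸ rfl⟩)
      rw [List.filter_cons_of_neg (by simpa using hcx)]
      exact filter_offset_eq_singleton hnd.2 h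

/-- with distinct offsets, `blockAt x` is the one block labelled `x`. [folklore] -/
theorem blockAt_eq_of_nodup (hnd : T.offsets.Nodup) {x : Fin (d + 1) → ℤ} {blk : List (Fin N × Fin N × ℚ)}
    (hb : (x, blk) ∈ T.blocks) : T.blockAt x = blk := by
  unfold blockAt
  rw [filter_offset_eq_singleton hnd hb]
  simp

/-! ## §3 The table symmetry by sort-and-compare -/

/-- the sort key `i·N + j` of an entry. [folklore] -/
def keyNat (e : Fin N × Fin N × ℚ) : ℕ := e.1.val * N + e.2.1.val

/-- the canonical sort of a block (merge sort by `keyNat`, fuel = length). [folklore] -/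
def sortBlock (blk : List (Fin N × Fin N × ℚ)) : List (Fin N × Fin N × ℚ) :=
  msortF (fun a b => decide (keyNat a ≤ keyNat b)) blk.length blk

omit T in
/-- the canonical sort is a permutation. [folklore] -/
theorem sortBlock_perm (blk : List (Fin N × Fin N × ℚ)) : (sortBlock blk).Perm blk := msortF_perm _ _ _

/-- **THE SORTED SYMMETRY CHECK**: distinct offsets, and every block `(x, blk)` has a partner block `(−x, blk')` with `blk' = sortBlock (blk.map tEntry)`
(so a canonical export lists each block sorted by `i·N + j`). Cost `Σ_x |blk_x| log |blk_x|` + `|offsets|²`. [folklore] -/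
def negTCheckSorted : Bool :=
  decide T.offsets.Nodup &&
    T.blocks.all fun b => T.blocks.any fun b' => decide (b'.1 = -b.1) && decide (b'.2 = sortBlock (b.2.map tEntry))

/-- what the sorted check says. [folklore] -/
theorem negTCheckSorted_spec (h : T.negTCheckSorted = true) :
    T.offsets.Nodup ∧ ∀ b ∈ T.blocks, ∃ b' ∈ T.blocks, b'.1 = -b.1 ∧ b'.2 = sortBlock (b.2.map tEntry) := by
  unfold negTCheckSorted at h
  simp only [Bool.and_eq_true, decide_eq_true_eq, List.all_eq_true, List.any_eq_true] at h
  exact ⟨h.1, fun b hb => by obtain ⟨b', hb', h1, h2⟩ := h.2 b hb; exact ⟨b', hb', h1, h2⟩⟩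

/-- the support is closed under negation when the sorted check passes. [folklore] -/
theorem neg_mem_support_of_sorted (h : T.negTCheckSorted = true) : ∀ x ∈ T.support, -x ∈ T.support := by
  intro x hx
  obtain ⟨blk, hb⟩ := T.mem_support.mp hx
  obtain ⟨b', hb', h1, -⟩ := (T.negTCheckSorted_spec h).2 _ hb
  exact T.mem_support.mpr ⟨b'.2, by rw [← h1]; exact hb'⟩

/-- **THE TABLE SYMMETRY FROM THE SORTED CHECK**: `K[−x] = K[x]ᵀ` on the support. [folklore] -/
theorem K_neg_of_sorted (h : T.negTCheckSorted = true) : ∀ x ∈ T.support, T.K (-x) = (T.K x)ᵀ := by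
  intro x hx
  obtain ⟨hnd, hall⟩ := T.negTCheckSorted_spec h
  obtain ⟨blk, hb⟩ := T.mem_support.mp hx
  obtain ⟨b', hb', h1, h2⟩ := hall _ hb
  have hbx : T.blockAt x = blk := T.blockAt_eq_of_nodup hnd hb
  have hbnx : T.blockAt (-x) = b'.2 := T.blockAt_eq_of_nodup hnd (by rw [← h1]; exact hb')
  ext a b
  simp only [Matrix.transpose_apply, K_apply, entryQ_eq_valAt, hbx, hbnx, h2]
  congr 1
  rw [valAt_perm (sortBlock_perm _), valAt_map_tEntry]

/-- **`MatNegTranspose` OF THE LETTER FROM THE SORTED CHECK** (binder `hAn`). [folklore] -/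
theorem matNegTranspose_family_of_sorted (h : T.negTCheckSorted = true) : MatNegTranspose T.family :=
  matNegTranspose_characterSum T.support T.K (T.neg_mem_support_of_sorted h) (T.K_neg_of_sorted h)

/-! ## §4 The table norms from sorted keys -/

/-- strictly increasing list of naturals (structural). [folklore] -/
def strictIncr : List ℕ → Bool
  | a :: b :: rest => decide (a < b) && strictIncr (b :: rest)
  | _ => true

omit T in
/-- a strictly increasing list is pairwise `<`. [folklore] -/
theorem pairwise_lt_of_strictIncr : ∀ {l : List ℕ}, strictIncr l = true → l.Pairwise (· < ·)
  | [], _ => List.Pairwise.nil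
  | [a], _ => List.pairwise_singleton _ _
  | a :: b :: rest, h => by
    simp only [strictIncr, Bool.and_eq_true, decide_eq_true_eq] at h
    have ih := pairwise_lt_of_strictIncr h.2
    refine List.Pairwise.cons ?_ ih
    intro c hc
    rcases List.mem_cons.mp hc with rfl | hc'
    · exact h.1
    · exact lt_trans h.1 (List.rel_of_pairwise_cons ih hc')

omit T in
/-- strictly increasing sort keys ⟹ distinct keys. [folklore] -/
theorem keys_nodup_of_strictIncr {blk : List (Fin N × Fin N × ℚ)} (h : strictIncr (blk.map keyNat) = true) : (keys blk).Nodup := by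
  have hp := pairwise_lt_of_strictIncr h
  rw [List.pairwise_map] at hp
  unfold keys
  rw [List.Nodup, List.pairwise_map]
  refine hp.imp fun {a b} hab => ?_
  intro heq
  have h1 : a.1 = b.1 := by simpa using congrArg Prod.fst heq
  have h2 : a.2.1 = b.2.1 := by simpa using congrArg Prod.snd heq
  have he : keyNat a = keyNat b := by unfold keyNat; rw [h1, h2]
  omega

/-- **THE SORTED NORM CHECK**: per listed offset, sort keys strictly increasing, `Σ v² ≤ ν_x²`, `0 ≤ ν_x` (linear cost). [folklore] -/
def normCheckSorted (ν : (Fin (d + 1) → ℤ) → ℚ) : Bool :=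
  T.offsets.all fun x => strictIncr ((T.blockAt x).map keyNat) && decide (sqSum (T.blockAt x) ≤ ν x ^ 2) && decide (0 ≤ ν x)

/-- **THE TABLE NORMS FROM THE SORTED CHECK**: `normCheckSorted T ν = true ⟹ ∀ x ∈ support, ‖K[x]‖ ≤ ν_x`. [folklore] -/
theorem norm_K_le_of_normCheckSorted {ν : (Fin (d + 1) → ℤ) → ℚ} (h : T.normCheckSorted ν = true) :
    ∀ x ∈ T.support, ‖T.K x‖ ≤ ((ν x : ℚ) : ℝ) := by
  intro x hx
  unfold normCheckSorted at h
  rw [List.all_eq_true] at h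
  have h' := h x (List.mem_toFinset.mp hx)
  simp only [Bool.and_eq_true, decide_eq_true_eq] at h'
  obtain ⟨⟨hs, hsq⟩, h0⟩ := h'
  have hk := keys_nodup_of_strictIncr hs
  refine (l2_opNorm_le_frobenius _).trans ?_
  rw [T.frobSq_K_eq x hk]
  have hs' : ((sqSum (T.blockAt x) : ℚ) : ℝ) ≤ ((ν x : ℚ) : ℝ) ^ 2 := by exact_mod_cast hsq
  have h0' : (0 : ℝ) ≤ ((ν x : ℚ) : ℝ) := by exact_mod_cast h0
  calc Real.sqrt ((sqSum (T.blockAt x) : ℚ) : ℝ) ≤ Real.sqrt (((ν x : ℚ) : ℝ) ^ 2) := Real.sqrt_le_sqrt hs'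
    _ = ((ν x : ℚ) : ℝ) := Real.sqrt_sq h0'

/-! ## §5 Composition ENDs on the sorted checks -/

/-- **THE (Z2b) BINDER OF A TYPED LETTER FROM THE SORTED NORM CHECK + ONE `checkUB`**. [folklore] -/
theorem tableSup_family_of_sortedChecks {ν : (Fin (d + 1) → ℤ) → ℚ} (hν : T.normCheckSorted ν = true) {κ Sκ : ℚ} {Sc Kt kt : ℕ}
    (hSc : 0 < Sc) (hcheck : checkUB Sc Kt kt (tubeTerms T.offsets ν fun _ => κ) Sκ.num Sκ.den = true) :
    ∀ q ∈ VertexTori (fun _ : Fin (d + 1) => ((κ : ℚ) : ℝ)), ‖T.family q‖ ≤ ((Sκ : ℚ) : ℝ) :=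
  tableSup_of_checkUB T.offsets_toFinset (T.norm_K_le_of_normCheckSorted hν) hSc hcheck

/-- **THE SIGN-FREE TAYLOR TAIL OF A TYPED LETTER FROM THE SORTED NORM CHECK + ONE `checkUB`**. [folklore] -/
theorem taylorTail_family_le_of_sortedChecks {ν : (Fin (d + 1) → ℤ) → ℚ} (hν : T.normCheckSorted ν = true) {m : ℕ}
    {c : Fin (d + 1) → ℂ} {κ : ℚ} (hc : ∀ μ, |(c μ).im| ≤ ((κ : ℚ) : ℝ)) {h : Fin (d + 1) → ℚ} (hh : ∀ μ, 0 ≤ h μ)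
    {Sc Kt kt : ℕ} (hSc : 0 < Sc) {Tt : ℚ} (hcheck : checkUB Sc Kt kt (tailTermsSup m T.offsets ν κ h) Tt.num Tt.den = true) :
    taylorTail m T.support T.K c (fun μ => ((h μ : ℚ) : ℝ)) ≤ ((Tt : ℚ) : ℝ) :=
  taylorTail_le_of_checkUB_sup T.offsets_toFinset (T.norm_K_le_of_normCheckSorted hν) hc hh (fun _ => rfl) hSc hcheck

end QTable

/-! ## §6 The toy table passes the sorted checks too -/

section Toy

/-- KERNEL: the toy table of `StencilTableData` §6 (blocks sorted, one per offset) passes the sorted symmetry check. [folklore] -/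
theorem toyT_negTCheckSorted : toyT.negTCheckSorted = true := by decide +kernel

/-- KERNEL: and the sorted norm check. [folklore] -/
theorem toyT_normCheckSorted : toyT.normCheckSorted toyν = true := by decide +kernel

end Toy

end

end Summit.QuantumFields.BalabanUV.Beta.StencilTableData
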